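import Literature.MathematicalPhysics.QuantumFieldTheory.AbelianVortexClustering
import Mathlib.Analysis.SpecificLimits.Normed
import HarnessLib

/-!
# Exponential clustering of gauge-invariant local observables in the Higgs phase of finite abelian lattice gauge theories (torus states)

Support file for the discharge of `Literature.Barriers.QuantumFields.ZnHiggsPhaseD4` through the
torus core fact `ZnTorusClusteringD4` of `DiscreteSubgroupFreezingProofs.lean`. For a FINITE
ABELIAN gauge group `G` with a continuous unitary matrix representation `ρ` having an *action
gap* `δ > 0` (`N - Re tr ρ(g) ≥ δ` for `g ≠ 1`; e.g. `ℤ_n ⊂ U(1)`), the torus Wilson states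
`⟨·⟩_{Λ_L, β}` of Wave 0 (`wilsonExpectation ρ β`) at large `β` cluster exponentially on
gauge-invariant local observables of `ℤ^d` transported to the torus (`toTorusObservable`),
uniformly in the volume (`abelianHiggs_torus_clustering`). The proof assembles

* the finite-group bridge `wilsonExpectation_eq_gibbsAverage` and the identity
  `e^{-β S(U)} = Wt φ_β (ω_U)` (`exp_neg_mul_wilsonAction`) expressing the Wilson weight through
  the plaquette field `ω_U = plaqField U` with `φ_β(a) = e^{-β (N - Re tr ρ(a))}`;
* the transport of a gauge-invariant cylinder observable `F` supported in a box of `ℤ^d` to a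
  function `plaqObs L F B` of the torus plaquette configuration determined by the projected box
  plaquettes `B` (`IsZdGaugeInvariant.eq_of_plaquette_eq`), with
  `plaqObs L F B (ω_U) = F (torusLift L U)` (`plaqObs_plaqField`);
* the torus clustering bound `LatticeForm.KPRegime.norm_exactCov_le` of
  `AbelianVortexClustering` (cluster expansion of the vortex gas + Peierls), whose hypotheses
  (the KP regime for `β` large via the action gap, the level separation of the two boxes along
  the axis of `‖x‖_∞`, and the smallness of the Peierls error `δ_{L}` for large `L`) are verified
  here.

## References

* I. Montvay, G. Münster, *Quantum Fields on a Lattice* (1994), §3.7.1 item 3 (discrete gauge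
  groups: Higgs phase at very large `β`, Peierls argument). [MontvayMunster1994]
* M. P. Forsström, Comm. Math. Phys. 393 (2022), Thm. 1, Rem. 7. [Forsstrom2022]
* R. Marra, S. Miracle-Solé, Comm. Math. Phys. 67 (1979) 233–240. [MarraMiraclesole1979]
-/

noncomputable section

open Finset Function Filter MeasureTheory
open scoped Topology
open Literature.MathematicalPhysics.QuantumLattice
open Literature.Probability.LatticeModels (Torus.proj Torus.proj_apply IsPolymerCluster KPTouches GeomInc)

namespace Literature.MathematicalPhysics.QuantumFieldTheory

open LatticeForm

/-! ### The Wilson weight through the plaquette field -/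

section Weight

variable {d L N : ℕ} [NeZero L] {G : Type*} [CommGroup G]

/-- The single-plaquette Wilson weight `φ_β(a) = e^{-β (N - Re tr ρ(a))}` on `Additive G`. [folklore] -/
def wilsonPhi (ρ : G →* Matrix (Fin N) (Fin N) ℂ) (β : ℝ) (a : Additive G) : ℝ :=
  Real.exp (-β * ((N : ℝ) - (ρ (Additive.toMul a)).trace.re))

/-- `φ_β(0) = 1`. [folklore] -/
theorem wilsonPhi_zero (ρ : G →* Matrix (Fin N) (Fin N) ℂ) (β : ℝ) : wilsonPhi ρ β 0 = 1 := by
  simp [wilsonPhi, Matrix.trace_one]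

/-- `φ_β ≥ 0`. [folklore] -/
theorem wilsonPhi_nonneg (ρ : G →* Matrix (Fin N) (Fin N) ℂ) (β : ℝ) (a : Additive G) : 0 ≤ wilsonPhi ρ β a :=
  (Real.exp_pos _).le

/-- With an action gap `δ ≤ N - Re tr ρ(g)` off the identity and `β ≥ 0`: `φ_β(a) ≤ e^{-βδ}` for
`a ≠ 0`. [cite: MontvayMunster1994, §3.7.1 item 3 (3.460) (PDF p. 164)] -/
theorem wilsonPhi_le_of_gap (ρ : G →* Matrix (Fin N) (Fin N) ℂ) {β δ : ℝ} (hβ : 0 ≤ β)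
    (hgap : ∀ g : G, g ≠ 1 → δ ≤ (N : ℝ) - (ρ g).trace.re) (a : Additive G) (ha : a ≠ 0) :
    wilsonPhi ρ β a ≤ Real.exp (-(β * δ)) := by
  unfold wilsonPhi
  refine Real.exp_le_exp.2 ?_
  have h := hgap (Additive.toMul a) (by simpa using ha)
  nlinarith

/-- **The Wilson weight is a plaquette-field weight**: `e^{-β S(U)} = ∏_p φ_β(ω_U(p))`. [folklore] -/
theorem exp_neg_mul_wilsonAction (ρ : G →* Matrix (Fin N) (Fin N) ℂ) (β : ℝ) (U : GaugeConfig d L G) :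
    Real.exp (-β * wilsonAction ρ U) = Wt (wilsonPhi ρ β) (plaqField U) := by
  rw [wilsonAction, Finset.mul_sum, Real.exp_sum, Wt]
  refine Finset.prod_congr rfl fun p _ => ?_
  rw [wilsonPhi, plaqField_apply, toMul_ofMul]

/-- **The KP regime at large `β`**: if `β ≥ 0` and `(Δ+1)² |G| e^{-βδ} e² ≤ 1/2` then the Wilson
weights are in the Kotecký–Preiss regime with `ε = e^{-βδ}`, `τ = 1`. [cite: MontvayMunster1994, §3.7.1 item 3 (PDF p. 164)] -/
theorem kpRegime_wilsonPhi [Fintype G] (ρ : G →* Matrix (Fin N) (Fin N) ℂ) {β δ : ℝ} (hβ : 0 ≤ β)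
    (hgap : ∀ g : G, g ≠ 1 → δ ≤ (N : ℝ) - (ρ g).trace.re)
    (hsmall : ((cubeDeg d : ℝ) + 1) ^ 2 *
      ((Fintype.card (Additive G) : ℝ) * Real.exp (-(β * δ)) * Real.exp (1 + 1)) ≤ 1 / 2) :
    KPRegime d (Additive G) (wilsonPhi ρ β) (Real.exp (-(β * δ))) 1 where
  zero := wilsonPhi_zero ρ β
  nonneg := wilsonPhi_nonneg ρ β
  eps_nonneg := (Real.exp_pos _).le
  le_eps := wilsonPhi_le_of_gap ρ hβ hgap
  tau_nonneg := zero_le_one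
  small := hsmall

/-- For `δ > 0` the smallness condition holds for all large `β`. [folklore] -/
theorem eventually_kp_small (d : ℕ) (M : ℝ) {δ : ℝ} (hδ : 0 < δ) :
    ∃ β₀ : ℝ, 0 ≤ β₀ ∧ ∀ β : ℝ, β₀ ≤ β →
      ((cubeDeg d : ℝ) + 1) ^ 2 * (M * Real.exp (-(β * δ)) * Real.exp (1 + 1)) ≤ 1 / 2 := by
  have ht : Tendsto (fun β : ℝ => ((cubeDeg d : ℝ) + 1) ^ 2 * (M * Real.exp (-(β * δ)) * Real.exp (1 + 1)))
      atTop (𝓝 0) := by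
    have h1 : Tendsto (fun β : ℝ => β * δ) atTop atTop := tendsto_id.atTop_mul_const hδ
    have h2 : Tendsto (fun β : ℝ => Real.exp (-(β * δ))) atTop (𝓝 0) :=
      Real.tendsto_exp_neg_atTop_nhds_zero.comp h1
    have h3 := (tendsto_const_nhds (x := ((cubeDeg d : ℝ) + 1) ^ 2)).mul
      (((tendsto_const_nhds (x := M)).mul h2).mul (tendsto_const_nhds (x := Real.exp (1 + 1))))
    simpa using h3
  have hev := (ht.eventually (gt_mem_nhds (by norm_num : (0 : ℝ) < 1 / 2)))
  obtain ⟨β₁, hβ₁⟩ := Filter.eventually_atTop.1 hev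
  exact ⟨max β₁ 0, le_max_right _ _, fun β hβ => (hβ₁ β ((le_max_left _ _).trans hβ)).le⟩

end Weight

/-! ### Transport of gauge-invariant local observables of `ℤ^d` to plaquette functions on the torus -/

section Transport

variable {d L : ℕ} [NeZero L] {G : Type*} [CommGroup G]

/-- A classical selection of a configuration satisfying a predicate (the trivial configuration if
there is none). [folklore] -/
def selP (P : GaugeConfig d L G → Prop) : GaugeConfig d L G := by
  classical exact if h : ∃ U, P U then h.choose else 1

omit [NeZero L] in
/-- The selection satisfies the predicate when possible. [folklore] -/
theorem selP_spec {P : GaugeConfig d L G → Prop} (h : ∃ U, P U) : P (selP P) := by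
  classical
  unfold selP
  rw [dif_pos h]
  exact h.choose_spec

/-- The plaquettes of the torus below the box `[a, b]` of `ℤ^d`. [folklore] -/
def boxPlaqT (L : ℕ) (a b : Literature.Probability.LatticeModels.Site d) : Finset (Plaquette d L) :=
  (Finset.Icc a b ×ˢ (Finset.univ : Finset {p : Fin d × Fin d // p.1 < p.2})).image
    fun q => ((Torus.proj L q.1 : Site d L), q.2)

omit [NeZero L] in
/-- The projection of a box plaquette lies in `boxPlaqT`. [folklore] -/
theorem mem_boxPlaqT {a b y : Literature.Probability.LatticeModels.Site d} (hy : y ∈ Set.Icc a b)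
    (s : {p : Fin d × Fin d // p.1 < p.2}) : ((Torus.proj L y : Site d L), s) ∈ boxPlaqT L a b :=
  Finset.mem_image.2 ⟨(y, s), Finset.mem_product.2 ⟨Finset.mem_Icc.2 ⟨hy.1, hy.2⟩, Finset.mem_univ _⟩, rfl⟩

omit [NeZero L] in
/-- `#boxPlaqT ≤ #box · #planes`. [folklore] -/
theorem card_boxPlaqT_le (a b : Literature.Probability.LatticeModels.Site d) :
    (boxPlaqT L a b).card ≤ (Finset.Icc a b).card * Fintype.card {p : Fin d × Fin d // p.1 < p.2} :=
  Finset.card_image_le.trans (by rw [Finset.card_product, Finset.card_univ])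

/-- **The plaquette version of an observable**: evaluate `F` on the periodic lift of a
configuration whose plaquette field agrees with `η` on `B` (if any). [folklore] -/
def plaqObs (L : ℕ) [NeZero L] (F : LGConfig d G → ℝ) (B : Finset (Plaquette d L))
    (η : Plaquette d L → Additive G) : ℝ :=
  F (torusLift L (selP fun U : GaugeConfig d L G => ∀ p ∈ B, plaqField U p = η p))

/-- `plaqObs` is determined by the values on `B`. [folklore] -/
theorem isDet_plaqObs (F : LGConfig d G → ℝ) (B : Finset (Plaquette d L)) :
    IsDet (fun η => (plaqObs L F B η : ℂ)) B := by
  intro η η' h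
  have hP : (fun U : GaugeConfig d L G => ∀ p ∈ B, plaqField U p = η p) =
      fun U : GaugeConfig d L G => ∀ p ∈ B, plaqField U p = η' p := by
    funext U
    exact propext ⟨fun hU p hp => (hU p hp).trans (h p hp), fun hU p hp => (hU p hp).trans (h p hp).symm⟩
  simp only [plaqObs, hP]

/-- `|plaqObs| ≤ sup |F|`. [folklore] -/
theorem norm_plaqObs_le {F : LGConfig d G → ℝ} {C : ℝ} (hF : ∀ U, |F U| ≤ C) (B : Finset (Plaquette d L))
    (η : Plaquette d L → Additive G) : ‖(plaqObs L F B η : ℂ)‖ ≤ C := by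
  rw [Complex.norm_real, Real.norm_eq_abs]; exact hF _

omit [NeZero L] in
/-- Plaquette holonomies of the periodic lift are the torus plaquette holonomies. [folklore] -/
theorem plaquetteHolonomyZd_torusLift_eq (U : GaugeConfig d L G)
    (y : Literature.Probability.LatticeModels.Site d) (i j : Fin d) :
    plaquetteHolonomyZd (torusLift L U) y i j = plaquetteHolonomy U (Torus.proj L y) i j := by
  simp only [plaquetteHolonomyZd, plaquetteHolonomy, torusLift, torusEdge, Function.comp_apply,
    Site.shift, torusProj_site_add, torusProj_site_single]

omit [NeZero L] in
/-- Degenerate plaquette holonomies are trivial. [folklore] -/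
theorem plaquetteHolonomyZd_self (V : LGConfig d G) (y : Literature.Probability.LatticeModels.Site d)
    (i : Fin d) : plaquetteHolonomyZd V y i i = 1 := by
  simp [plaquetteHolonomyZd]

omit [NeZero L] in
/-- Reversing the orientation inverts the plaquette holonomy (abelian group). [folklore] -/
theorem plaquetteHolonomyZd_swap (V : LGConfig d G) (y : Literature.Probability.LatticeModels.Site d)
    (i j : Fin d) : plaquetteHolonomyZd V y j i = (plaquetteHolonomyZd V y i j)⁻¹ := by
  simp only [plaquetteHolonomyZd, mul_inv_rev, inv_inv]
  simp only [mul_comm, mul_left_comm, mul_assoc]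

/-- **The plaquette version computes the observable**: for a gauge-invariant cylinder observable
supported in the box `[a, b]`, `plaqObs L F (boxPlaqT L a b) (ω_U) = F (torusLift L U)`.
[cite: ForsstromLenellsViklund2022, §1.2 (gauge invariant functions depend on the plaquette configuration)] -/
theorem plaqObs_plaqField {F : LGConfig d G → ℝ} (hG : IsZdGaugeInvariant F) {S : Finset (ZdEdge d)}
    (hS : IsCylinder F S) {a b : Literature.Probability.LatticeModels.Site d}
    (hSbox : ∀ e ∈ S, e.1 ∈ Set.Icc a b ∧ e.1 + LatticeForm.e e.2 ∈ Set.Icc a b) (U : GaugeConfig d L G) :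
    plaqObs L F (boxPlaqT L a b) (plaqField U) = F (torusLift L U) := by
  unfold plaqObs
  set P : GaugeConfig d L G → Prop := fun U' => ∀ p ∈ boxPlaqT L a b, plaqField U' p = plaqField U p
    with hP
  have hsel : P (selP P) := selP_spec ⟨U, fun _ _ => rfl⟩
  refine IsZdGaugeInvariant.eq_of_plaquette_eq hG hS hSbox fun y i j hy _ => ?_
  rw [plaquetteHolonomyZd_torusLift_eq, plaquetteHolonomyZd_torusLift_eq]
  -- reduce to genuine plaquettes `i < j`
  have key : ∀ i j : Fin d, i < j →
      plaquetteHolonomy (selP P) (Torus.proj L y) i j = plaquetteHolonomy U (Torus.proj L y) i j := by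
    intro i j hij
    have h := hsel ((Torus.proj L y : Site d L), ⟨(i, j), hij⟩) (mem_boxPlaqT hy _)
    rw [plaqField_apply, plaqField_apply] at h
    exact Additive.ofMul.injective h
  rcases lt_trichotomy i j with hij | rfl | hji
  · exact key i j hij
  · rw [← plaquetteHolonomyZd_torusLift_eq, ← plaquetteHolonomyZd_torusLift_eq,
      plaquetteHolonomyZd_self, plaquetteHolonomyZd_self]
  · rw [← plaquetteHolonomyZd_torusLift_eq, ← plaquetteHolonomyZd_torusLift_eq,
      plaquetteHolonomyZd_swap _ y j i, plaquetteHolonomyZd_swap _ y j i,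
      plaquetteHolonomyZd_torusLift_eq, plaquetteHolonomyZd_torusLift_eq, key j i hji]

/-! ### Translated observables -/

omit [NeZero L] in
/-- Translation intertwines gauge transformations: `θ_x (U^g) = (θ_x U)^{g(· - x)}`. [folklore] -/
theorem configShift_gaugeTransformZd [MeasurableSpace G] (x : Literature.Probability.LatticeModels.Site d)
    (g : Literature.Probability.LatticeModels.Site d → G) (U : LGConfig d G) :
    configShift x (gaugeTransformZd g U) = gaugeTransformZd (fun y => g (y - x)) (configShift x U) := by
  funext e
  simp only [configShift_apply, gaugeTransformZd]
  congr 2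
  abel_nf

omit [NeZero L] in
/-- A translate of a gauge-invariant observable is gauge invariant. [folklore] -/
theorem isZdGaugeInvariant_comp_configShift [MeasurableSpace G] {α : Type*} {F : LGConfig d G → α}
    (hF : IsZdGaugeInvariant F) (x : Literature.Probability.LatticeModels.Site d) :
    IsZdGaugeInvariant (F ∘ configShift x) := by
  intro g U
  simp only [Function.comp_apply, configShift_gaugeTransformZd]
  exact hF _ _

end Transport

/-! ### Circular distance of integer residues; levels of box plaquettes -/

namespace LatticeForm

variable {L : ℕ} [NeZero L]

omit [NeZero L] in
/-- `cdist z c = cdist (z - c) 0`. [folklore] -/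
theorem cdist_eq_sub (z c : ZMod L) : cdist z c = cdist (z - c) 0 := by
  unfold cdist; rw [sub_zero]

/-- `cdist (-z) 0 = cdist z 0`. [folklore] -/
theorem cdist_neg_zero (z : ZMod L) : cdist (-z) 0 = cdist z 0 := by
  unfold cdist
  rw [sub_zero, sub_zero]
  rcases eq_or_ne z 0 with rfl | hz
  · simp
  · rw [ZMod.neg_val, if_neg hz]
    have h1 := ZMod.val_lt z
    have h2 : 0 < z.val := Nat.pos_of_ne_zero fun h => hz ((ZMod.val_eq_zero z).1 h)
    omega

omit [NeZero L] in
/-- For `0 ≤ t < L`, `cdist t 0 ≤ t`. [folklore] -/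
theorem cdist_natCast_zero_le {t : ℕ} (ht : t < L) : cdist ((t : ZMod L)) 0 ≤ t := by
  unfold cdist
  rw [sub_zero, ZMod.val_natCast, Nat.mod_eq_of_lt ht]
  exact min_le_left _ _

omit [NeZero L] in
/-- For `v ≤ t` and `t + v ≤ L`, `v ≤ cdist t 0`. [folklore] -/
theorem le_cdist_natCast_zero {t v : ℕ} (h1 : v ≤ t) (h2 : t + v ≤ L) : v ≤ cdist ((t : ZMod L)) 0 := by
  rcases Nat.eq_zero_or_pos v with rfl | hv
  · exact Nat.zero_le _
  unfold cdist
  rw [sub_zero, ZMod.val_natCast, Nat.mod_eq_of_lt (by omega)]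
  exact le_min h1 (by omega)

/-- Integer version: `cdist t 0 ≤ |t|` for `|t| < L`. [folklore] -/
theorem cdist_intCast_zero_le {t : ℤ} (ht : t.natAbs < L) : cdist ((t : ZMod L)) 0 ≤ t.natAbs := by
  rcases Int.natAbs_eq t with h | h
  · conv_lhs => rw [h]
    rw [Int.cast_natCast]; exact cdist_natCast_zero_le ht
  · conv_lhs => rw [h]
    rw [Int.cast_neg, Int.cast_natCast, cdist_neg_zero]; exact cdist_natCast_zero_le ht

/-- Integer version: `v ≤ cdist t 0` for `v ≤ |t|` and `|t| + v ≤ L`. [folklore] -/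
theorem le_cdist_intCast_zero {t : ℤ} {v : ℕ} (h1 : v ≤ t.natAbs) (h2 : t.natAbs + v ≤ L) :
    v ≤ cdist ((t : ZMod L)) 0 := by
  rcases Int.natAbs_eq t with h | h
  · conv_rhs => rw [h]
    rw [Int.cast_natCast]; exact le_cdist_natCast_zero h1 h2
  · conv_rhs => rw [h]
    rw [Int.cast_neg, Int.cast_natCast, cdist_neg_zero]; exact le_cdist_natCast_zero h1 h2

end LatticeForm

section Levels

variable {d L : ℕ} [NeZero L]

/-- The level of a projected box plaquette along the axis `k`, relative to the residue of `c₀`,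
is at most `u` if `|y k - c₀| ≤ u < L` on the box. [folklore] -/
theorem torusLevel_le_of_mem_boxPlaqT {a b : Literature.Probability.LatticeModels.Site d} (k : Fin d)
    (c₀ : ℤ) {u : ℕ} (h : ∀ y ∈ Set.Icc a b, (y k - c₀).natAbs ≤ u) (huL : u < L) {p : Plaquette d L}
    (hp : p ∈ boxPlaqT L a b) : torusLevel k ((c₀ : ℤ) : ZMod L) p ≤ u := by
  obtain ⟨q, hq, rfl⟩ := Finset.mem_image.1 hp
  obtain ⟨hy, -⟩ := Finset.mem_product.1 hq
  have hy' : q.1 ∈ Set.Icc a b := ⟨(Finset.mem_Icc.1 hy).1, (Finset.mem_Icc.1 hy).2⟩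
  have hb := h q.1 hy'
  unfold torusLevel
  rw [LatticeForm.cdist_eq_sub]
  simp only [Torus.proj_apply]
  rw [← Int.cast_sub]
  exact (LatticeForm.cdist_intCast_zero_le (by omega)).trans hb

/-- The level of a projected box plaquette is at least `v` if `v ≤ |y k - c₀|` and
`|y k - c₀| + v ≤ L` on the box. [folklore] -/
theorem le_torusLevel_of_mem_boxPlaqT {a b : Literature.Probability.LatticeModels.Site d} (k : Fin d)
    (c₀ : ℤ) {v : ℕ} (h : ∀ y ∈ Set.Icc a b, v ≤ (y k - c₀).natAbs ∧ (y k - c₀).natAbs + v ≤ L)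
    {p : Plaquette d L} (hp : p ∈ boxPlaqT L a b) : v ≤ torusLevel k ((c₀ : ℤ) : ZMod L) p := by
  obtain ⟨q, hq, rfl⟩ := Finset.mem_image.1 hp
  obtain ⟨hy, -⟩ := Finset.mem_product.1 hq
  have hy' : q.1 ∈ Set.Icc a b := ⟨(Finset.mem_Icc.1 hy).1, (Finset.mem_Icc.1 hy).2⟩
  obtain ⟨h1, h2⟩ := h q.1 hy'
  unfold torusLevel
  rw [LatticeForm.cdist_eq_sub]
  simp only [Torus.proj_apply]
  rw [← Int.cast_sub]
  exact LatticeForm.le_cdist_intCast_zero h1 h2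

/-- The number of sites of a translated box. [folklore] -/
theorem card_Icc_sub_eq (a b x : Literature.Probability.LatticeModels.Site d) :
    (Finset.Icc (a - x) (b - x)).card = (Finset.Icc a b).card := by
  rw [Pi.card_Icc, Pi.card_Icc]
  refine Finset.prod_congr rfl fun k _ => ?_
  rw [Int.card_Icc, Int.card_Icc]
  congr 1
  simp only [Pi.sub_apply]
  ring

end Levels

/-! ### Expectations of transported observables -/

section Expect

variable {d L N : ℕ} [NeZero L] {G : Type*} [CommGroup G] [Fintype G] [DecidableEq G]
  [TopologicalSpace G] [DiscreteTopology G] [IsTopologicalGroup G] [MeasurableSpace G] [BorelSpace G]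

omit [DecidableEq G] [DiscreteTopology G] in
/-- Torus expectations are homogeneous. [folklore] -/
theorem wilsonExpectation_const_mul (ρ : G →* Matrix (Fin N) (Fin N) ℂ) (β c : ℝ) (F : GaugeConfig d L G → ℝ) :
    wilsonExpectation ρ β (fun U => c * F U) = c * wilsonExpectation ρ β F := by
  unfold wilsonExpectation
  exact integral_const_mul c F

/-- **Torus expectation of a transported gauge-invariant box observable as an exact-ensemble
expectation of its plaquette version.** [folklore] -/
theorem wilsonExpectation_toTorusObservable_eq (ρ : G →* Matrix (Fin N) (Fin N) ℂ) (hρ : Continuous ρ)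
    (β : ℝ) {F : LGConfig d G → ℝ} (hG : IsZdGaugeInvariant F) {S : Finset (ZdEdge d)} (hS : IsCylinder F S)
    {a b : Literature.Probability.LatticeModels.Site d}
    (hSbox : ∀ e ∈ S, e.1 ∈ Set.Icc a b ∧ e.1 + LatticeForm.e e.2 ∈ Set.Icc a b) :
    wilsonExpectation ρ β (toTorusObservable L F) = exactAvgR (wilsonPhi ρ β) (plaqObs L F (boxPlaqT L a b)) := by
  rw [wilsonExpectation_eq_gibbsAverage ρ hρ β]
  have hnum : ∑ U : GaugeConfig d L G, toTorusObservable L F U * Real.exp (-β * wilsonAction ρ U) =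
      ∑ U : GaugeConfig d L G, plaqObs L F (boxPlaqT L a b) (plaqField U) * Wt (wilsonPhi ρ β) (plaqField U) :=
    Finset.sum_congr rfl fun U _ => by
      rw [toTorusObservable_apply, plaqObs_plaqField hG hS hSbox, exp_neg_mul_wilsonAction]
  have hden : ∑ U : GaugeConfig d L G, Real.exp (-β * wilsonAction ρ U) =
      ∑ U : GaugeConfig d L G, Wt (wilsonPhi ρ β) (plaqField U) :=
    Finset.sum_congr rfl fun U _ => exp_neg_mul_wilsonAction ρ β U
  rw [hnum, hden]
  exact gibbsAverage_eq_exactAvgR (wilsonPhi ρ β) (fun _ => rfl) _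

/-- The same for the product of two transported box observables. [folklore] -/
theorem wilsonExpectation_toTorusObservable_mul_eq (ρ : G →* Matrix (Fin N) (Fin N) ℂ) (hρ : Continuous ρ)
    (β : ℝ) {F₁ F₂ : LGConfig d G → ℝ} (hG₁ : IsZdGaugeInvariant F₁) (hG₂ : IsZdGaugeInvariant F₂)
    {S₁ S₂ : Finset (ZdEdge d)} (hS₁ : IsCylinder F₁ S₁) (hS₂ : IsCylinder F₂ S₂)
    {a₁ b₁ a₂ b₂ : Literature.Probability.LatticeModels.Site d}
    (hbox₁ : ∀ e ∈ S₁, e.1 ∈ Set.Icc a₁ b₁ ∧ e.1 + LatticeForm.e e.2 ∈ Set.Icc a₁ b₁)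
    (hbox₂ : ∀ e ∈ S₂, e.1 ∈ Set.Icc a₂ b₂ ∧ e.1 + LatticeForm.e e.2 ∈ Set.Icc a₂ b₂) :
    wilsonExpectation ρ β (toTorusObservable L fun U => F₁ U * F₂ U) =
      exactAvgR (wilsonPhi ρ β)
        (fun η => plaqObs L F₁ (boxPlaqT L a₁ b₁) η * plaqObs L F₂ (boxPlaqT L a₂ b₂) η) := by
  rw [wilsonExpectation_eq_gibbsAverage ρ hρ β]
  have hnum : ∑ U : GaugeConfig d L G, toTorusObservable L (fun U => F₁ U * F₂ U) U * Real.exp (-β * wilsonAction ρ U) =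
      ∑ U : GaugeConfig d L G, (plaqObs L F₁ (boxPlaqT L a₁ b₁) (plaqField U) *
        plaqObs L F₂ (boxPlaqT L a₂ b₂) (plaqField U)) * Wt (wilsonPhi ρ β) (plaqField U) :=
    Finset.sum_congr rfl fun U _ => by
      rw [toTorusObservable_apply, plaqObs_plaqField hG₁ hS₁ hbox₁, plaqObs_plaqField hG₂ hS₂ hbox₂,
        exp_neg_mul_wilsonAction]
  have hden : ∑ U : GaugeConfig d L G, Real.exp (-β * wilsonAction ρ U) =
      ∑ U : GaugeConfig d L G, Wt (wilsonPhi ρ β) (plaqField U) :=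
    Finset.sum_congr rfl fun U _ => exp_neg_mul_wilsonAction ρ β U
  rw [hnum, hden]
  exact gibbsAverage_eq_exactAvgR (wilsonPhi ρ β) (fun _ => rfl)
    (fun η => plaqObs L F₁ (boxPlaqT L a₁ b₁) η * plaqObs L F₂ (boxPlaqT L a₂ b₂) η)

omit [TopologicalSpace G] [DiscreteTopology G] [IsTopologicalGroup G] [MeasurableSpace G] [BorelSpace G] in
/-- Exact-ensemble expectations of real observables bounded by `1` are bounded by `1`. [folklore] -/
theorem abs_exactAvgR_le {φ : Additive G → ℝ} (hφ0 : φ 0 = 1) (hφ : ∀ a, 0 ≤ φ a)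
    (f : (Plaquette d L → Additive G) → ℝ) (hf : ∀ η, |f η| ≤ 1) : |exactAvgR φ f| ≤ 1 := by
  have h := norm_exactAvg_le (d := d) (L := L) hφ0 hφ (fun η => (f η : ℂ)) (fun η => by
    rw [Complex.norm_real, Real.norm_eq_abs]; exact hf η)
  rwa [exactAvg_ofReal, Complex.norm_real, Real.norm_eq_abs] at h

end Expect

/-! ### The Peierls error vanishes as the torus grows -/

section PeierlsLimit

open LatticeForm

/-- **`δ_{L} → 0`**: the Peierls sum at threshold `L/2` tends to zero along the tori
(`peierlsSum_le`: `δ_L ≤ #plaquettes · 4λ 2^{-L/2}` and `#plaquettes ≤ d² L^d`). [folklore] -/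
theorem tendsto_peierlsSum (d : ℕ) {lam : ℝ} (hlam : 0 ≤ lam)
    (hsmall : ((cubeDeg d : ℝ) + 1) ^ 2 * (2 * lam) ≤ 1 / 2) :
    Tendsto (fun L : ℕ => peierlsSum d (L + 1) lam ((L + 1) / 2)) atTop (𝓝 0) := by
  set r : ℝ := Real.sqrt (1 / 2) with hr
  have hr0 : 0 < r := Real.sqrt_pos.2 (by norm_num)
  have hr1 : r < 1 := by
    rw [hr, Real.sqrt_lt' one_pos]; norm_num
  have hr2 : r ^ 2 = 1 / 2 := by rw [hr, Real.sq_sqrt]; norm_num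
  -- the comparison sequence
  have hg : Tendsto (fun L : ℕ => ((L + 1 : ℕ) : ℝ) ^ d * r ^ (L + 1)) atTop (𝓝 0) :=
    (tendsto_pow_const_mul_const_pow_of_lt_one d hr0.le hr1).comp (tendsto_add_atTop_nat 1)
  have hg' : Tendsto (fun L : ℕ => (4 * lam * (d : ℝ) ^ 2 / r) * (((L + 1 : ℕ) : ℝ) ^ d * r ^ (L + 1)))
      atTop (𝓝 0) := by
    simpa using hg.const_mul (4 * lam * (d : ℝ) ^ 2 / r)
  refine squeeze_zero (fun L => peierlsSum_nonneg hlam _) (fun L => ?_) hg'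
  haveI : NeZero (L + 1) := ⟨Nat.succ_ne_zero L⟩
  have h1 := peierlsSum_le (d := d) (L := L + 1) hlam hsmall ((L + 1) / 2)
  have hcard : (Fintype.card (Plaquette d (L + 1)) : ℝ) ≤ (d : ℝ) ^ 2 * ((L + 1 : ℕ) : ℝ) ^ d := by
    have := card_plaquette_le (d := d) (L := L + 1)
    exact_mod_cast this
  have hhalf : (1 / 2 : ℝ) ^ ((L + 1) / 2) ≤ r ^ (L + 1) / r := by
    rw [le_div_iff₀ hr0, ← hr2, ← pow_mul, ← pow_succ]
    exact pow_le_pow_of_le_one hr0.le hr1.le (by omega)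
  calc peierlsSum d (L + 1) lam ((L + 1) / 2)
      ≤ Fintype.card (Plaquette d (L + 1)) * (4 * lam * (1 / 2) ^ ((L + 1) / 2)) := h1
    _ ≤ ((d : ℝ) ^ 2 * ((L + 1 : ℕ) : ℝ) ^ d) * (4 * lam * (r ^ (L + 1) / r)) := by
        refine mul_le_mul hcard (mul_le_mul_of_nonneg_left hhalf (by positivity)) (by positivity)
          (by positivity)
    _ = (4 * lam * (d : ℝ) ^ 2 / r) * (((L + 1 : ℕ) : ℝ) ^ d * r ^ (L + 1)) := by
        field_simp

end PeierlsLimit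

/-! ### Supports in boxes; the sup norm on `ℤ^d` -/

section Boxes

variable {d : ℕ}

/-- The constant site. [folklore] -/
def cst (d : ℕ) (c : ℤ) : Literature.Probability.LatticeModels.Site d := fun _ => c

/-- A finite edge set is contained, with its endpoints, in a cube `[-R, R]^d`. [folklore] -/
theorem exists_cube_of_finset (S : Finset (ZdEdge d)) :
    ∃ R : ℕ, ∀ e ∈ S, ∀ k : Fin d, (e.1 k).natAbs + 1 ≤ R := by
  classical
  refine ⟨1 + S.sup (fun e => (Finset.univ : Finset (Fin d)).sup fun k => (e.1 k).natAbs), ?_⟩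
  intro e he k
  have h1 : (e.1 k).natAbs ≤ (Finset.univ : Finset (Fin d)).sup (fun k => (e.1 k).natAbs) :=
    Finset.le_sup (f := fun k => (e.1 k).natAbs) (Finset.mem_univ k)
  have h2 : (Finset.univ : Finset (Fin d)).sup (fun k => (e.1 k).natAbs) ≤
      S.sup (fun e => (Finset.univ : Finset (Fin d)).sup fun k => (e.1 k).natAbs) :=
    Finset.le_sup (f := fun e => (Finset.univ : Finset (Fin d)).sup fun k => (e.1 k).natAbs) he
  omega

/-- Edges with all base coordinates of modulus `≤ R - 1` lie, with their endpoints, in the cube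
`[-R, R]^d`. [folklore] -/
theorem sbox_of_cube {S : Finset (ZdEdge d)} {R : ℕ} (h : ∀ e ∈ S, ∀ k : Fin d, (e.1 k).natAbs + 1 ≤ R) :
    ∀ e ∈ S, e.1 ∈ Set.Icc (cst d (-(R : ℤ))) (cst d R) ∧
      e.1 + LatticeForm.e e.2 ∈ Set.Icc (cst d (-(R : ℤ))) (cst d R) := by
  intro e he
  have hk : ∀ k, -(R : ℤ) ≤ e.1 k ∧ e.1 k + 1 ≤ R := fun k => by
    have := h e he k; omega
  have hek : ∀ k, (e.1 + LatticeForm.e e.2) k = e.1 k + if k = e.2 then 1 else 0 := fun k => by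
    simp [LatticeForm.e, Pi.single_apply]
  refine ⟨⟨fun k => ?_, fun k => ?_⟩, ⟨fun k => ?_, fun k => ?_⟩⟩
  · simp only [cst]; exact (hk k).1
  · simp only [cst]; have := (hk k).2; omega
  · rw [hek k]; simp only [cst]; have := (hk k).1; split_ifs <;> omega
  · rw [hek k]; simp only [cst]; have := (hk k).2; split_ifs <;> omega

/-- Translating the support translates the box. [folklore] -/
theorem sbox_shift {S : Finset (ZdEdge d)} {a b : Literature.Probability.LatticeModels.Site d}
    (h : ∀ e ∈ S, e.1 ∈ Set.Icc a b ∧ e.1 + LatticeForm.e e.2 ∈ Set.Icc a b)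
    (x : Literature.Probability.LatticeModels.Site d) :
    ∀ e ∈ S.image (fun e : ZdEdge d => (e.1 - x, e.2)),
      e.1 ∈ Set.Icc (a - x) (b - x) ∧ e.1 + LatticeForm.e e.2 ∈ Set.Icc (a - x) (b - x) := by
  intro e he
  obtain ⟨e₀, he₀, rfl⟩ := Finset.mem_image.1 he
  obtain ⟨⟨h1, h2⟩, ⟨h3, h4⟩⟩ := h e₀ he₀
  have hsub : ∀ k, (e₀.1 - x + LatticeForm.e e₀.2) k = (e₀.1 + LatticeForm.e e₀.2) k - x k := fun k => by
    simp only [Pi.add_apply, Pi.sub_apply]; ring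
  have A : ∀ k, a k ≤ e₀.1 k := h1
  have B : ∀ k, e₀.1 k ≤ b k := h2
  have C : ∀ k, a k ≤ (e₀.1 + LatticeForm.e e₀.2) k := h3
  have D : ∀ k, (e₀.1 + LatticeForm.e e₀.2) k ≤ b k := h4
  refine ⟨⟨fun k => ?_, fun k => ?_⟩, ⟨fun k => ?_, fun k => ?_⟩⟩
  · show a k - x k ≤ e₀.1 k - x k
    linarith [A k]
  · show e₀.1 k - x k ≤ b k - x k
    linarith [B k]
  · show a k - x k ≤ (e₀.1 - x + LatticeForm.e e₀.2) k
    rw [hsub k]; linarith [C k]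
  · show (e₀.1 - x + LatticeForm.e e₀.2) k ≤ b k - x k
    rw [hsub k]; linarith [D k]

/-- The sup norm of an integer vector is its largest coordinate modulus. [folklore] -/
theorem norm_eq_natAbs_of_max (x : Literature.Probability.LatticeModels.Site d) (k : Fin d)
    (hk : ∀ j, (x j).natAbs ≤ (x k).natAbs) : ‖x‖ = (x k).natAbs := by
  have hxk : ‖x k‖ = ((x k).natAbs : ℝ) := by
    rw [Int.norm_eq_abs, Nat.cast_natAbs, Int.cast_abs]
  refine le_antisymm ?_ ?_
  · refine (pi_norm_le_iff_of_nonneg (Nat.cast_nonneg _)).2 fun j => ?_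
    rw [Int.norm_eq_abs]
    have : ((x j).natAbs : ℝ) ≤ (x k).natAbs := by exact_mod_cast hk j
    rw [Nat.cast_natAbs, Int.cast_abs] at this
    exact this
  · rw [← hxk]; exact norm_le_pi_norm x k

end Boxes

/-! ### The clustering theorem -/

section Main

open LatticeForm

/-- Monotonicity of the cluster-expansion constant in the box sizes. [folklore] -/
theorem gamma_mono {M : ℝ} (hM : 1 ≤ 2 * M) {n₁ n₂ P : ℕ} (h₁ : n₁ ≤ P) (h₂ : n₂ ≤ P) {t : ℝ} (ht : 0 ≤ t) :
    (2 * M) ^ n₁ * (2 * M) ^ n₂ * (6 * n₁ * Real.exp (6 * n₁ + 2 * n₂) * t) ≤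
      (2 * M) ^ P * (2 * M) ^ P * (6 * P * Real.exp (6 * P + 2 * P) * t) := by
  have hp₁ : (2 * M) ^ n₁ ≤ (2 * M) ^ P := pow_le_pow_right₀ hM h₁
  have hp₂ : (2 * M) ^ n₂ ≤ (2 * M) ^ P := pow_le_pow_right₀ hM h₂
  have hn₁ : (n₁ : ℝ) ≤ P := by exact_mod_cast h₁
  have hn₂ : (n₂ : ℝ) ≤ P := by exact_mod_cast h₂
  have hexp : Real.exp (6 * n₁ + 2 * n₂) ≤ Real.exp (6 * P + 2 * P) := Real.exp_le_exp.2 (by linarith)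
  have h0 : (0 : ℝ) ≤ (2 * M) ^ n₁ := pow_nonneg (by linarith) _
  have h3 : 6 * (n₁ : ℝ) * Real.exp (6 * n₁ + 2 * n₂) * t ≤ 6 * P * Real.exp (6 * P + 2 * P) * t := by
    refine mul_le_mul_of_nonneg_right ?_ ht
    exact mul_le_mul (by linarith) hexp (Real.exp_nonneg _) (by positivity)
  calc (2 * M) ^ n₁ * (2 * M) ^ n₂ * (6 * n₁ * Real.exp (6 * n₁ + 2 * n₂) * t)
      ≤ (2 * M) ^ P * (2 * M) ^ P * (6 * n₁ * Real.exp (6 * n₁ + 2 * n₂) * t) := by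
        refine mul_le_mul_of_nonneg_right (mul_le_mul hp₁ hp₂ (pow_nonneg (by linarith) _)
          (pow_nonneg (by linarith) _)) (by positivity)
    _ ≤ (2 * M) ^ P * (2 * M) ^ P * (6 * P * Real.exp (6 * P + 2 * P) * t) :=
        mul_le_mul_of_nonneg_left h3 (by positivity)

/-- **Exponential clustering in the Higgs phase of finite abelian lattice gauge theories (torus
states, uniformly in the volume).** Let `G` be a finite abelian group, `ρ` a continuous matrix
representation with an action gap `δ > 0` (`N - Re tr ρ(g) ≥ δ` for `g ≠ 1`), `d ≥ 3`. There is
`β_f` such that for all `β > β_f` and all bounded gauge-invariant local observables `F₁, F₂` of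
`ℤ^d` there is `C` with: for every `x ∈ ℤ^d` and all sufficiently large torus sizes `L + 1`,
`|⟨F₁ · (F₂ ∘ θ_x)⟩_{L+1,β} - ⟨F₁⟩_{L+1,β} ⟨F₂ ∘ θ_x⟩_{L+1,β}| ≤ C e^{-‖x‖_∞}`
(contour expansion: `LatticeForm.KPRegime.norm_exactCov_le`). The rate `1` reflects the choice
`τ = 1` in the Kotecký–Preiss weights; any rate is reached for larger `β_f`.
[cite: MontvayMunster1994, §3.7.1 item 3 (PDF p. 164)] [cite: Forsstrom2022, Thm. 1 and Remark 7] -/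
theorem abelianHiggs_torus_clustering {d N : ℕ} (hd : 3 ≤ d) {G : Type*} [CommGroup G] [Fintype G]
    [DecidableEq G] [TopologicalSpace G] [DiscreteTopology G] [IsTopologicalGroup G] [MeasurableSpace G]
    [BorelSpace G] (ρ : G →* Matrix (Fin N) (Fin N) ℂ) (hρ : Continuous ρ) {δ : ℝ} (hδ : 0 < δ)
    (hgap : ∀ g : G, g ≠ 1 → δ ≤ (N : ℝ) - (ρ g).trace.re) :
    ∃ β_f : ℝ, ∀ β : ℝ, β_f < β →
      ∀ F₁ F₂ : LGConfig d G → ℝ, IsLocalObservable F₁ → IsLocalObservable F₂ →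
      (∃ C, ∀ U, |F₁ U| ≤ C) → (∃ C, ∀ U, |F₂ U| ≤ C) → IsZdGaugeInvariant F₁ → IsZdGaugeInvariant F₂ →
      ∃ C : ℝ, ∀ x : Literature.Probability.LatticeModels.Site d, ∀ᶠ L : ℕ in atTop,
        |wilsonExpectation (L := L + 1) ρ β (toTorusObservable (L + 1) fun U => F₁ U * F₂ (configShift x U)) -
            wilsonExpectation (L := L + 1) ρ β (toTorusObservable (L + 1) F₁) *
              wilsonExpectation (L := L + 1) ρ β (toTorusObservable (L + 1) (F₂ ∘ configShift x))| ≤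
          C * Real.exp (-1 * ‖x‖) := by
  classical
  -- the regime
  set Mc : ℝ := (Fintype.card (Additive G) : ℝ) with hMc
  obtain ⟨β₀, hβ₀0, hβ₀⟩ := eventually_kp_small d Mc hδ
  refine ⟨β₀, fun β hβ F₁ F₂ hloc₁ hloc₂ hbd₁ hbd₂ hG₁ hG₂ => ?_⟩
  obtain ⟨S₁, hS₁⟩ := hloc₁
  obtain ⟨S₂, hS₂⟩ := hloc₂
  obtain ⟨C₁, hC₁⟩ := hbd₁
  obtain ⟨C₂, hC₂⟩ := hbd₂
  have hβ0 : 0 ≤ β := hβ₀0.trans hβ.le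
  set ε : ℝ := Real.exp (-(β * δ)) with hε
  set φ : Additive G → ℝ := wilsonPhi ρ β with hφ
  have hsmallβ := hβ₀ β hβ.le
  have hKP : KPRegime d (Additive G) φ ε 1 := kpRegime_wilsonPhi ρ hβ0 hgap hsmallβ
  have hMc1 : 1 ≤ Mc := by
    rw [hMc]; exact_mod_cast Fintype.card_pos (α := Additive G)
  have hε0 : 0 ≤ ε := (Real.exp_pos _).le
  have hlam0 : 0 ≤ Mc * ε := mul_nonneg (by linarith) hε0
  have hsmall2 : ((cubeDeg d : ℝ) + 1) ^ 2 * (2 * (Mc * ε)) ≤ 1 / 2 := by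
    have he2 : (2 : ℝ) ≤ Real.exp (1 + 1) := by
      have := Real.add_one_le_exp (1 + 1 : ℝ); linarith
    have h1 : 2 * (Mc * ε) ≤ Mc * ε * Real.exp (1 + 1) := by nlinarith
    exact le_trans (mul_le_mul_of_nonneg_left h1 (by positivity)) hsmallβ
  -- normalisation
  set c₁ : ℝ := max C₁ 1 with hc₁
  set c₂ : ℝ := max C₂ 1 with hc₂
  have hc₁pos : 0 < c₁ := lt_of_lt_of_le one_pos (le_max_right _ _)
  have hc₂pos : 0 < c₂ := lt_of_lt_of_le one_pos (le_max_right _ _)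
  set Fn₁ : LGConfig d G → ℝ := fun U => F₁ U / c₁ with hFn₁def
  set Fn₂ : LGConfig d G → ℝ := fun U => F₂ U / c₂ with hFn₂def
  have hFn₁ : ∀ U, |Fn₁ U| ≤ 1 := fun U => by
    rw [hFn₁def]; dsimp only
    rw [abs_div, abs_of_pos hc₁pos, div_le_one hc₁pos]
    exact (hC₁ U).trans (le_max_left _ _)
  have hFn₂ : ∀ U, |Fn₂ U| ≤ 1 := fun U => by
    rw [hFn₂def]; dsimp only
    rw [abs_div, abs_of_pos hc₂pos, div_le_one hc₂pos]
    exact (hC₂ U).trans (le_max_left _ _)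
  have hSn₁ : IsCylinder Fn₁ S₁ := fun U V hUV => by
    show F₁ U / c₁ = F₁ V / c₁; rw [hS₁ hUV]
  have hSn₂ : IsCylinder Fn₂ S₂ := fun U V hUV => by
    show F₂ U / c₂ = F₂ V / c₂; rw [hS₂ hUV]
  have hGn₁ : IsZdGaugeInvariant Fn₁ := fun g U => by
    show F₁ (gaugeTransformZd g U) / c₁ = F₁ U / c₁; rw [hG₁ g U]
  have hGn₂ : IsZdGaugeInvariant Fn₂ := fun g U => by
    show F₂ (gaugeTransformZd g U) / c₂ = F₂ U / c₂; rw [hG₂ g U]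
  -- the common cube
  obtain ⟨R, hR⟩ := exists_cube_of_finset (S₁ ∪ S₂)
  have hR₁ : ∀ e ∈ S₁, ∀ k : Fin d, (e.1 k).natAbs + 1 ≤ R := fun e he => hR e (Finset.mem_union_left _ he)
  have hR₂ : ∀ e ∈ S₂, ∀ k : Fin d, (e.1 k).natAbs + 1 ≤ R := fun e he => hR e (Finset.mem_union_right _ he)
  set a : Literature.Probability.LatticeModels.Site d := cst d (-(R : ℤ)) with ha
  set b : Literature.Probability.LatticeModels.Site d := cst d R with hb
  have hbox₁ : ∀ e ∈ S₁, e.1 ∈ Set.Icc a b ∧ e.1 + LatticeForm.e e.2 ∈ Set.Icc a b := sbox_of_cube hR₁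
  have hbox₂ : ∀ e ∈ S₂, e.1 ∈ Set.Icc a b ∧ e.1 + LatticeForm.e e.2 ∈ Set.Icc a b := sbox_of_cube hR₂
  -- constants
  set P : ℕ := (Finset.Icc a b).card * Fintype.card {p : Fin d × Fin d // p.1 < p.2} with hP
  set Γ₀ : ℝ := (2 * Mc) ^ P * (2 * Mc) ^ P * (6 * P * Real.exp (6 * P + 2 * P)) with hΓ₀
  have hΓ₀0 : 0 ≤ Γ₀ := by rw [hΓ₀]; positivity
  set Cfin : ℝ := max (c₁ * c₂ * (Γ₀ * Real.exp (4 * R + 1) + 1)) (2 * c₁ * c₂ * Real.exp (4 * R + 2))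
    with hCfin
  refine ⟨Cfin, fun x => ?_⟩
  -- the translated observable
  set Fn₂x : LGConfig d G → ℝ := Fn₂ ∘ configShift x with hFn₂xdef
  have hFn₂x : ∀ U, |Fn₂x U| ≤ 1 := fun U => hFn₂ _
  have hSn₂x : IsCylinder Fn₂x (S₂.image fun e => (e.1 - x, e.2)) := IsCylinder.comp_configShift hSn₂ x
  have hGn₂x : IsZdGaugeInvariant Fn₂x := isZdGaugeInvariant_comp_configShift hGn₂ x
  have hbox₂x := sbox_shift hbox₂ x
  -- the axis of `‖x‖`
  have hne : (Finset.univ : Finset (Fin d)).Nonempty := Finset.univ_nonempty_iff.2 ⟨⟨0, by omega⟩⟩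
  obtain ⟨k, -, hk⟩ := Finset.exists_max_image Finset.univ (fun j => (x j).natAbs) hne
  have hnorm : ‖x‖ = (x k).natAbs := norm_eq_natAbs_of_max x k fun j => hk j (Finset.mem_univ j)
  set xk : ℕ := (x k).natAbs with hxk
  -- expectation identities (every torus size)
  have hscale : ∀ L : ℕ,
      wilsonExpectation (L := L + 1) ρ β (toTorusObservable (L + 1) fun U => F₁ U * F₂ (configShift x U)) -
        wilsonExpectation (L := L + 1) ρ β (toTorusObservable (L + 1) F₁) *
          wilsonExpectation (L := L + 1) ρ β (toTorusObservable (L + 1) (F₂ ∘ configShift x)) =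
      (c₁ * c₂) * (exactAvgR (φ) (fun η => plaqObs (L + 1) Fn₁ (boxPlaqT (L + 1) a b) η *
            plaqObs (L + 1) Fn₂x (boxPlaqT (L + 1) (a - x) (b - x)) η) -
          exactAvgR φ (plaqObs (L + 1) Fn₁ (boxPlaqT (L + 1) a b)) *
            exactAvgR φ (plaqObs (L + 1) Fn₂x (boxPlaqT (L + 1) (a - x) (b - x)))) := by
    intro L
    have e12 : (toTorusObservable (L + 1) fun U => F₁ U * F₂ (configShift x U)) =
        fun U => (c₁ * c₂) * toTorusObservable (L + 1) (fun U => Fn₁ U * Fn₂x U) U := by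
      funext U
      simp only [toTorusObservable_apply, hFn₂xdef, hFn₁def, hFn₂def, Function.comp_apply]
      field_simp
    have e1 : toTorusObservable (L + 1) F₁ = fun U => c₁ * toTorusObservable (L + 1) Fn₁ U := by
      funext U
      simp only [toTorusObservable_apply, hFn₁def]
      field_simp
    have e2 : toTorusObservable (L + 1) (F₂ ∘ configShift x) = fun U => c₂ * toTorusObservable (L + 1) Fn₂x U := by
      funext U
      simp only [toTorusObservable_apply, hFn₂xdef, hFn₂def, Function.comp_apply]
      field_simp
    rw [e12, e1, e2, wilsonExpectation_const_mul, wilsonExpectation_const_mul, wilsonExpectation_const_mul,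
      wilsonExpectation_toTorusObservable_mul_eq ρ hρ β hGn₁ hGn₂x hSn₁ hSn₂x hbox₁ hbox₂x,
      wilsonExpectation_toTorusObservable_eq ρ hρ β hGn₁ hSn₁ hbox₁,
      wilsonExpectation_toTorusObservable_eq ρ hρ β hGn₂x hSn₂x hbox₂x]
    ring
  -- trivial bound
  have hφ0 : φ 0 = 1 := hKP.zero
  have hφnn : ∀ a, 0 ≤ φ a := hKP.nonneg
  have habs₁ : ∀ (L : ℕ) (η : Plaquette d (L + 1) → Additive G), |plaqObs (L + 1) Fn₁ (boxPlaqT (L + 1) a b) η| ≤ 1 :=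
    fun L η => hFn₁ _
  have habs₂ : ∀ (L : ℕ) (η : Plaquette d (L + 1) → Additive G),
      |plaqObs (L + 1) Fn₂x (boxPlaqT (L + 1) (a - x) (b - x)) η| ≤ 1 := fun L η => hFn₂x _
  have htriv : ∀ L : ℕ,
      |exactAvgR (φ) (fun η => plaqObs (L + 1) Fn₁ (boxPlaqT (L + 1) a b) η *
            plaqObs (L + 1) Fn₂x (boxPlaqT (L + 1) (a - x) (b - x)) η) -
          exactAvgR φ (plaqObs (L + 1) Fn₁ (boxPlaqT (L + 1) a b)) *
            exactAvgR φ (plaqObs (L + 1) Fn₂x (boxPlaqT (L + 1) (a - x) (b - x)))| ≤ 2 := by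
    intro L
    have h1 := abs_exactAvgR_le (d := d) (L := L + 1) hφ0 hφnn _ (habs₁ L)
    have h2 := abs_exactAvgR_le (d := d) (L := L + 1) hφ0 hφnn _ (habs₂ L)
    have h12 := abs_exactAvgR_le (d := d) (L := L + 1) hφ0 hφnn
      (fun η => plaqObs (L + 1) Fn₁ (boxPlaqT (L + 1) a b) η *
        plaqObs (L + 1) Fn₂x (boxPlaqT (L + 1) (a - x) (b - x)) η) (fun η => by
        rw [abs_mul]; exact mul_le_one₀ (habs₁ L η) (abs_nonneg _) (habs₂ L η))
    have hprod : |exactAvgR φ (plaqObs (L + 1) Fn₁ (boxPlaqT (L + 1) a b)) *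
        exactAvgR φ (plaqObs (L + 1) Fn₂x (boxPlaqT (L + 1) (a - x) (b - x)))| ≤ 1 := by
      rw [abs_mul]; exact mul_le_one₀ h1 (abs_nonneg _) h2
    have := abs_sub _ _ |>.trans (add_le_add h12 hprod)
    linarith
  -- the eventual conditions on the torus size
  have hev : ∀ᶠ L : ℕ in atTop, 2 * xk + 4 * R + 4 ≤ L ∧
      peierlsSum d (L + 1) (Mc * ε) ((L + 1) / 2) < min (1 / 2) (Real.exp (-(xk : ℝ)) / 12) := by
    refine (Filter.eventually_ge_atTop (2 * xk + 4 * R + 4)).and ?_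
    have ht := tendsto_peierlsSum d hlam0 hsmall2
    exact (tendsto_order.1 ht).2 _ (lt_min (by norm_num) (by positivity))
  have hev' : ∀ᶠ L : ℕ in atTop, 2 * xk + 4 * R + 4 ≤ L + 1 ∧
      peierlsSum d (L + 1) (Mc * ε) ((L + 1) / 2) < min (1 / 2) (Real.exp (-(xk : ℝ)) / 12) :=
    hev.mono fun L hL => ⟨by have := hL.1; omega, hL.2⟩
  refine hev'.mono fun L hL => ?_
  obtain ⟨hLge, hpS⟩ := hL
  rw [hscale L, abs_mul, abs_of_pos (mul_pos hc₁pos hc₂pos), hnorm]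
  have hCfin1 : c₁ * c₂ * (Γ₀ * Real.exp (4 * R + 1) + 1) ≤ Cfin := le_max_left _ _
  have hCfin2 : 2 * c₁ * c₂ * Real.exp (4 * R + 2) ≤ Cfin := le_max_right _ _
  by_cases hsmallx : xk < 4 * R + 2
  · -- trivial regime
    have hexp1 : 1 ≤ Real.exp (4 * R + 2) * Real.exp (-1 * (xk : ℝ)) := by
      rw [← Real.exp_add]
      have hlt : (xk : ℝ) < 4 * R + 2 := by exact_mod_cast hsmallx
      exact Real.one_le_exp (by linarith)
    calc c₁ * c₂ * |_| ≤ c₁ * c₂ * 2 := mul_le_mul_of_nonneg_left (htriv L) (by positivity)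
      _ ≤ c₁ * c₂ * 2 * (Real.exp (4 * R + 2) * Real.exp (-1 * (xk : ℝ))) :=
          le_mul_of_one_le_right (by positivity) hexp1
      _ = (2 * c₁ * c₂ * Real.exp (4 * R + 2)) * Real.exp (-1 * (xk : ℝ)) := by ring
      _ ≤ Cfin * Real.exp (-1 * (xk : ℝ)) := mul_le_mul_of_nonneg_right hCfin2 (Real.exp_nonneg _)
  · -- contour expansion regime
    push Not at hsmallx
    set B₁ := boxPlaqT (L + 1) a b with hB₁def
    set B₂ := boxPlaqT (L + 1) (a - x) (b - x) with hB₂def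
    set f₁ := plaqObs (L + 1) Fn₁ B₁ with hf₁def
    set f₂ := plaqObs (L + 1) Fn₂x B₂ with hf₂def
    -- levels
    have hB₁lev : ∀ p ∈ B₁, torusLevel k (((-(R : ℤ)) : ℤ) : ZMod (L + 1)) p ≤ 2 * R := fun p hp =>
      torusLevel_le_of_mem_boxPlaqT k (-(R : ℤ)) (fun y hy => by
        have h1 : a k ≤ y k := hy.1 k
        have h2 : y k ≤ b k := hy.2 k
        simp only [ha, hb, cst] at h1 h2
        omega) (by omega) hp
    have hB₂lev : ∀ p ∈ B₂, xk - 2 * R ≤ torusLevel k (((-(R : ℤ)) : ℤ) : ZMod (L + 1)) p := fun p hp =>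
      le_torusLevel_of_mem_boxPlaqT k (-(R : ℤ)) (fun y hy => by
        have h1 : (a - x) k ≤ y k := hy.1 k
        have h2 : y k ≤ (b - x) k := hy.2 k
        simp only [ha, hb, cst, Pi.sub_apply] at h1 h2
        constructor <;> omega) hp
    have huv : 2 * R + 1 ≤ xk - 2 * R := by omega
    have hδhalf : peierlsSum d (L + 1) ((Fintype.card (Additive G) : ℝ) * ε) ((L + 1) / 2) ≤ 1 / 2 :=
      (hpS.trans_le (min_le_left _ _)).le
    have hmain := hKP.norm_exactCov_le hd (g₁ := fun η => (f₁ η : ℂ)) (g₂ := fun η => (f₂ η : ℂ))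
      (isDet_plaqObs Fn₁ B₁) (isDet_plaqObs Fn₂x B₂) (norm_plaqObs_le hFn₁ B₁) (norm_plaqObs_le hFn₂x B₂)
      k (((-(R : ℤ)) : ℤ) : ZMod (L + 1)) hB₁lev hB₂lev huv hδhalf
    -- identify the left-hand side
    have hlhs : ‖exactAvg φ (fun η => ((f₁ η : ℂ)) * (f₂ η : ℂ)) - exactAvg φ (fun η => (f₁ η : ℂ)) *
        exactAvg φ (fun η => (f₂ η : ℂ))‖ =
        |exactAvgR φ (fun η => f₁ η * f₂ η) - exactAvgR φ f₁ * exactAvgR φ f₂| := by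
      have : (fun η => ((f₁ η : ℂ)) * (f₂ η : ℂ)) = fun η => ((f₁ η * f₂ η : ℝ) : ℂ) := by
        funext η; push_cast; rfl
      rw [this, exactAvg_ofReal, exactAvg_ofReal, exactAvg_ofReal]
      norm_cast
    rw [hlhs] at hmain
    -- the constant
    have hcard₁ : B₁.card ≤ P := card_boxPlaqT_le a b
    have hcard₂ : B₂.card ≤ P := by
      have := card_boxPlaqT_le (L := L + 1) (a - x) (b - x)
      rwa [card_Icc_sub_eq] at this
    have hM2 : 1 ≤ 2 * Mc := by linarith
    have hΓ := gamma_mono hM2 hcard₁ hcard₂ (Real.exp_nonneg (-(1 * ((((xk - 2 * R : ℕ) : ℝ)) - (2 * R : ℕ) - 1))))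
    have hexpo : Real.exp (-(1 * ((((xk - 2 * R : ℕ) : ℝ)) - (2 * R : ℕ) - 1))) =
        Real.exp (4 * R + 1) * Real.exp (-1 * (xk : ℝ)) := by
      rw [← Real.exp_add]
      congr 1
      rw [Nat.cast_sub (by omega)]
      push_cast
      ring
    have hpS' : 12 * peierlsSum d (L + 1) ((Fintype.card (Additive G) : ℝ) * ε) ((L + 1) / 2) ≤
        Real.exp (-1 * (xk : ℝ)) := by
      have := (hpS.trans_le (min_le_right _ _)).le
      rw [← hMc] 
      have h' : Real.exp (-(xk : ℝ)) = Real.exp (-1 * (xk : ℝ)) := by ring_nf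
      rw [h'] at this
      linarith
    have hfin : |exactAvgR φ (fun η => f₁ η * f₂ η) - exactAvgR φ f₁ * exactAvgR φ f₂| ≤
        (Γ₀ * Real.exp (4 * R + 1) + 1) * Real.exp (-1 * (xk : ℝ)) := by
      refine hmain.trans ?_
      rw [hexpo] at hΓ
      calc _ ≤ (2 * Mc) ^ P * (2 * Mc) ^ P * (6 * P * Real.exp (6 * P + 2 * P) *
              (Real.exp (4 * R + 1) * Real.exp (-1 * (xk : ℝ)))) + Real.exp (-1 * (xk : ℝ)) := by
            rw [hexpo] ; exact add_le_add hΓ hpS'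
        _ = (Γ₀ * Real.exp (4 * R + 1) + 1) * Real.exp (-1 * (xk : ℝ)) := by rw [hΓ₀]; ring
    calc c₁ * c₂ * |exactAvgR φ (fun η => f₁ η * f₂ η) - exactAvgR φ f₁ * exactAvgR φ f₂|
        ≤ c₁ * c₂ * ((Γ₀ * Real.exp (4 * R + 1) + 1) * Real.exp (-1 * (xk : ℝ))) :=
          mul_le_mul_of_nonneg_left hfin (by positivity)
      _ = (c₁ * c₂ * (Γ₀ * Real.exp (4 * R + 1) + 1)) * Real.exp (-1 * (xk : ℝ)) := by ring
      _ ≤ Cfin * Real.exp (-1 * (xk : ℝ)) := mul_le_mul_of_nonneg_right hCfin1 (Real.exp_nonneg _)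

end Main

end Literature.MathematicalPhysics.QuantumFieldTheory

end
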